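import Mathlib
import HarnessLib
import HarnessLib.Audit
import Summits.Langlands.Statement

/-!
Route: WachCensus

CLOSED (retired) 2026-08-15T13:48:47Z by operator:999:1257524 — reason: not-a-thesis: assembly does not conclude the sub-problem Statement — note: D-0027 §2.1 audit (human 2026-08-15: routes that do not decide the summit are removed): the assembly concludes `SliceB2Unram`, not the sub-problem statement; a NEW conforming route may be opened from the same idea (generated `closes : … → _root_.Langlands`).. The file is kept as the record of this route; refuted decls are indexed as negative knowledge (`ledger negatives`).

Route WachCensus (idea card wach-module-component-census). THESIS X: it suffices to show PD2unr :=
"for every prime p >= 7 and every finite UNRAMIFIED K/Q_p, every crystalline rho : G_K ->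
GL_2(Qbar_p) with pairwise distinct labelled Hodge-Tate weights is potentially diagonalisable
(BLGGT, arXiv:1010.2561 §1.4), and in fact connects, after an UNRAMIFIED base change of degree <= 2,
to an ordinary representation or to a direct sum of crystalline characters" — proved by a CERTIFIED
COMPONENT CENSUS: compute semisimplified reductions of the explicit crystalline families
V_{lambda,a} (weakly admissible modules of Dousmanis2010/Guzman2024; reductions by the Breuil-Kisin
algorithm CarusoLubicz2013 for f >= 2, by Berger2011/Rozensztajn2018 for f = 1), determine the
connected (= irreducible, Kisin2007 smoothness) components of the rigid generic fibres
X_lambda(rhobar) of the framed crystalline deformation rings in UNBOUNDED weight (k_tau >= p+2,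
beyond GaoLiu2014/Bartlett2020), and exhibit on each component an ordinary or split/induced seed
(Dousmanis-type families), whence PD by the BLGGT §1.4 calculus. SUMMIT-FACING CONSEQUENCE (the
typed layer): PD2unr + the potentially-diagonalisable automorphy-lifting theorems
(BarnetlambEtAl2014 Thm 4.2.1, BarnetlambGeeGeraghty2013MathAnn App. A,
BarnetlambGeeGeraghty2013MRL) give LiftB2Unram = direction (B) of the summit for n = 2 over totally
real F in which p >= 7 is unramified, for irreducible totally odd rho that are crystalline at every
v | p with pairwise distinct labelled HT weights, with rhobar|_{F(zeta_p)} irreducible and rhobar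
automorphic — in EVERY weight and at a SINGLE prime, with no p-adic local Langlands input (the
barrier ModPLanglandsGL2BeyondQp says none is available for F_v != Q_p); together with residual
modularity over F (BuzzardDiamondJarvis2010, CARRIED, not attacked here) this is the (B)-slice
SliceB2Unram. Lean (elaborates, lean check rc 0): every typed statement has the summit's own shape
`forall F p ..., exists RD : ReciprocityData F, forall hcpt, (A)^{reg}_2 RD hcpt /\ <slice> RD hcpt`
(the known (A)-direction for regular L-algebraic cuspidal pi of GL_2/F is conjoined so that the
datum RD is pinned exactly as in the audited Statement.lean, audit brief V8); X itself (PD,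
deformation rings, V_{lambda,a}) is not yet typable — definition items filed — so the census cruxes
are informal at open and the route is opened as a CONDITIONAL BRIDGE on BuzzardDiamondJarvis2010.
One-line Lean target: SliceB2Unram (see route file); assembly LiftB2UnramSmallF -> LiftB2UnramLargeF
-> SerreModularityTR -> SliceB2Unram (proved in the planner's Sketch2.lean, attached as evidence).

CONDITIONAL on BuzzardDiamondJarvis2010 — this route is an explicit reduction to that named conjecture (D-0019: crux floor waived).

Rationale: WHY THIS LINE. At l = p every patching-based lifting theorem needs r|G_{F_v} on the same component
as an automorphic lift (PatchingLocalComponentBarrier); BLGGT's escape clause is potential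
diagonalisability (PD), asked in print for all crystalline reps (arXiv:1010.2561 §1.4: "as far as we
know they could all be"). Known: ordinary, Fontaine-Laffaille (BLGGT Lemma 1.4.3), HT in [0,p-1]
(GaoLiu2014), n=2 unramified HT in [0,p] (Bartlett2020), pot. Barsotti-Tate (GeeKisin2014 Lemma
4.4.1), n=3 weight (2,1,0) (BartlettLeHungLevin2026). OPEN: n = 2, K unramified (even K = Q_p), any
k_tau >= p+2 non-ordinary (BlancoChacon-Dieulefait 2021 can only produce PD modular lifts of SPECIAL
large weights). The card's bet: for GL_2 over unramified K the components are COMPUTABLE — f=1: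
X(k,rhobar) is a standard subset of the a_p-disc and R(k,rhobar)[1/p] = bounded functions on it,
determined by finitely many reductions (Rozensztajn2020 Thms 1-3); reductions are locally constant
with explicit radius 2v(a_p)+alpha(k-1) (Berger2011 Thm A); explicit families through the induced
point exist for every unramified f (Dousmanis2010, Guzman2024, BergerLiJunezhu2004); a
polynomial-time Breuil-Kisin reduction algorithm exists for every K (CarusoLubicz2013). Area
imported: computational/integral p-adic Hodge theory (Wach and Breuil-Kisin modules) + rigid
geometry of 1- and 2-dimensional generic fibres; certified computation (kit) mines the component
pattern, explicit families prove it.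
RANKED CRUXES (informal ones filed by workitem add; typed ones in the file):
 r2 SeedsOverQp2 [informal]: p>=5, k>=p+2, rhobar : G_{Q_p} -> GL_2: every connected component C of
X(k,rhobar) (incl. the Buzzard-Gee slope-(0,1) annulus for rhobar = ind w_2^{k-1}) maps into the
component of X_{(k,k)}(rhobar|Q_{p^2}) that contains the split point psi_1 + psi_2 (or an ordinary
point). First genuinely open case; cheapest kill (p=5, k<=30).
 r3 ComponentCensusUnram [informal]: Conjecture C for f<=2: every component of X_lambda(rhobar), K =
Q_{p^f}, lambda regular unbounded, meets the ordinary-or-split/induced locus after unramified base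
change of degree <= 2; sub-claim (future split): finite determination of pi_0 (explicit constancy
radius in the Frobenius parameters for f=2 + a priori bound #pi_0 <= e(R/varpi), a
Breuil-Mezard-type multiplicity).
 r4 PD2Unram [informal]: the conjecture X for all unramified f (census evidence f<=2, proof template
= families crossing components).
 r5 LiftB2UnramSmallF [typed]: the lifting slice when every v|p has residue degree <= 2 (the census
range). r6 LiftB2UnramLargeF [typed]: some f_v >= 3.
 support: SerreModularityTR [typed, CARRIED conditional: BDJ modularity, forall-RD form relative to
(A)^reg_2]; PDCalculusFacts, PDLiftingGL2 [cite items]; target SliceB2Unram; Assembly (propositional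
+ case split on residue degrees; proof attached).
KILL CRITERIA. r2 refuted (a component of some X(k,rhobar) whose base change to Q_{p^2}, and to
Q_{p^4}, carries no ordinary/split point) refutes C as stated and very likely PD itself -> close
route refuted (valuable: answers BLGGT's question); a non-PD crystalline rho of some G_{Q_{p^f}}
refutes PD2Unram and LiftB2Unram* -> closed refuted with census; typed slices found
vacuous/junk-witnessable -> restate (not close).
NOT DECOMPOSED YET: the f=2 constancy radius; HS-multiplicity bound; the Dousmanis-family proof
template per component type; n=3 / ramified K; nothing below two layers.
NOVELTY: nearest prior art searched (zbMATH x12 queries, lit read of arXiv:1010.2561 pp.14-15,26,30;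
1603.00763 p.3; 1705.01060 p.3; 0907.0221; 1904.12548; 1204.4704; 2008.04192; 1309.4194; 1205.4491;
2410.00729 p.1): Rozensztajn2020 (f=1 loci = standard subsets, finitely determined),
Bartlett2020/BartlettLeHungLevin2026 (PD by local models, bounded weight), Dousmanis2010/Guzman2024
(explicit unramified families), CarusoLubicz2013 (algorithm). DELTA: nobody has pointed the
explicit-reduction machinery at pi_0 of crystalline deformation spaces in UNBOUNDED weight to decide
PD, nor formulated the unramified-seed Conjecture C; the f=1 -> Q_{p^2} rung (r2) is new as a
statement. Grade expected: new-combination.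
BARRIERS: PatchingLocalComponentBarrier attacked head-on (X is its escape clause made universal for
GL_2/unramified); ModPLanglandsGL2BeyondQp(FpBar)/BreuilPaskunas2012_supersingularFamily evaded (no
representation theory of GL_2(F_v); Rozensztajn2018's LLC-based algorithm is replaced by
Berger/Caruso-Lubicz local algorithms for f>=2); TaylorWilesNumericalCoincidence(Narrow),
ResiduallyReducibleBarrier not engaged (GL_2 totally real = defect zero; rhobar|F(zeta_p)
irreducible assumed); NonRegularWeightBarrier not evaded (extra-regular weights assumed; typed as
2f_v distinct HT weights).

Novelty: Nearest prior art (searched: zbMATH "potentially diagonalizable crystalline representations"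
(GaoLiu2014, Bartlett2020, arXiv:2604.17466, arXiv:2008.04192), "local constancy reduction
crystalline" (Berger2011, arXiv:2109.13676, arXiv:1801.07754), "reductions crystalline
representations unramified" (Dousmanis2010, Guzman2024 = arXiv:2410.00729, arXiv:2607.08660,
arXiv:0807.1078), "locus crystalline representations given reduction" (Rozensztajn2020 =
arXiv:1705.01060), "crystabelline deformation rings" (arXiv:1702.06019), "Caruso Lubicz"
(CarusoLubicz2013 = arXiv:1309.4194); read: arXiv:1010.2561 §1.4 + Thm 4.2.1 + Cor 4.5.2,
arXiv:1705.01060 intro, arXiv:0907.0221 intro, arXiv:1904.12548 intro, arXiv:1603.00763 intro,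
arXiv:1205.4491 Thm 2.1.2): (i) Rozensztajn2020 — for K = Q_p the locus X(k,rhobar) is a standard
subset, R(k,rhobar)[1/p] is its ring of bounded functions, finitely many reductions determine it
(the f=1 census engine, unexploited for PD); (ii) Bartlett2020 / BartlettLeHungLevin2026 — PD via
Breuil-Kisin local models, bounded weight ([0,p] for n=2 unramified; (2,1,0) for n=3); (iii)
Dousmanis2010, Guzman2024, BergerLiJunezhu2004 — explicit families through induced points,
reductions at large valuation; (iv) CarusoLubicz2013 — polynomial-time semisimplified reduction for
any K (not cited by the card; replaces the LLC-based Rozensztajn2018 for f >= 2). DELTA: the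
combination [explicit/algorithmic reductions] x [PD is constant on components, components =
connected c  [refs: 2604.17466, 2008.04192, 2109.13676, 1801.07754, 2410.00729, 2607.08660, 0807.1078, 1705.01060, 1702.06019, 1309.4194, 1010.2561, 0907.0221, 1904.12548, 1603.00763, 1205.4491, GaoLiu2014, Bartlett2020, Berger2011, Dousmanis2010, Guzman2024, Rozensztajn2020, CarusoLubicz2013, BartlettLeHungLevin2026, BergerLiJunezhu2004, Rozensztajn2018]

Barriers (technique_class: wach-modules breuil-kisin pd-census automorphy-lifting): technique_class: wach-modules breuil-kisin pd-census automorphy-lifting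
Literature.Barriers.Langlands.PatchingLocalComponentBarrier: ATTACKED, not evaded — X (PD2unr) is
exactly the printed escape clause (BLGGT "r|G_{F_v} potentially diagonalisable") made universal for
GL_2 over unramified F_v; the route proves one-component-reachability by a census instead of
assuming it; if a component with no PD seed exists the census finds it (kill criterion).
Literature.Barriers.Langlands.ModPLanglandsGL2BeyondQpFpBar: evaded — no mod-p/p-adic local
Langlands for GL_2(F_v) is used; reductions for f >= 2 are computed by Breuil-Kisin/Wach semilinear
algebra (CarusoLubicz2013, Guzman2024), not by Rozensztajn2018's LLC-based method (which is f = 1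
only).
Literature.Barriers.Langlands.ModPLanglandsGL2BeyondQp: evaded, same reason; the lifting step
imports BLGGT-type theorems whose only l = p input is PD.
Literature.Barriers.Langlands.BreuilPaskunas2012_supersingularFamily: evaded — the abundance of
supersingular GL_2(Q_{p^f})-representations is irrelevant on the Galois side where the census lives.
Literature.Barriers.Langlands.TaylorWilesNumericalCoincidence: not engaged — GL_2 over totally real
F is the defect-zero setting the imported lifting theorems already handle.
Literature.Barriers.Langlands.TaylorWilesNumericalCoincidenceNarrow: not engaged, same.
Literature.Barriers.Langlands.ResiduallyReducibleBarrier: not engaged — rhobar|_{F(zeta_p)}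
irreducible is a standing hypothesis of every t

History (route lifecycle, newest last):
- 2026-08-15T13:48:47Z · CLOSED retired — not-a-thesis: assembly does not conclude the sub-problem Statement (operator:999:1257524)

sub-problem: Langlands · status: closed(retired) · opened planner-plancard-Langlands-Langlands-wach-mod-681c8d54-0 2026-08-15T11:02:29Z · rev 2 · ledger route-Langlands-WachCensus
GENERATED by the gate from the ledger (D-0016/17). Provers cite these decls: `theorem foo : Summit.Langlands.Langlands.Theses.WachCensus.<Decl> := …` in Summits/Langlands/Langlands/Theorems/<Name>.lean.
-/

namespace Summit.Langlands.Langlands.Theses.WachCensus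

open scoped BigOperators Topology Manifold Classical MeasureTheory ProbabilityTheory Matrix InnerProductSpace ComplexConjugate ContinuousMap
open Filter Set Function TopologicalSpace MeasureTheory

attribute [summit_statement] _root_.Langlands
-- H21.Audit: conditional_on 'BuzzardDiamondJarvis2010' is not an accepted declaration — no route_premise tag

/-- item stmt-Langlands-2221 · target · rank 0 · closed · moot by None · by planner
why it might fail: It is PD2Unram + PD lifting + BDJ residual modularity; fails if PD fails on some component over an unramified F_v, or if the typed (A)^reg_2 conjunct / extra-regularity clause is found vacuous or junk-witnessable (then restate).
sources: BuzzardGeeLMS2014, BarnetlambEtAl2014, BuzzardDiamondJarvis2010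
[target] (B)-slice of the summit for n = 2: for F totally real, p >= 7 unramified in F, there are
reciprocity data RD (pinned by the conjoined known (A)-direction for regular L-algebraic cuspidal pi
of GL_2/F, as in Statement.lean / audit V8) such that every irreducible, geometric, totally odd rho
: G_F -> GL_2(Qbar_p) which at every v | p is crystalline (de Rham + WD unramified with N = 0) with
2 f_v pairwise distinct Hodge-Tate weights, and whose reduction restricted to F(zeta_p) is
absolutely irreducible (trace-congruence formulation), corresponds (Corresponds RD iota pi rho:
Satake a.e. + local-global compatibility at every finite place) to an L-algebraic cuspidal pi. =
LiftB2Unram (this route) + residual modularity (BuzzardDiamondJarvis2010, carried). Sources: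
BuzzardGeeLMS2014 Conj 3.2.2; FontaineMazurGeometric1995 Conj 1; BarnetlambEtAl2014. -/
@[route_item "route-Langlands-WachCensus"]
def SliceB2Unram : Prop :=
  ∀ (F : Type) [Field F] [NumberField F] [NumberField.IsTotallyReal F] (p : ℕ) [Fact p.Prime], 7 ≤ p → ¬ ((p : ℤ) ∣ NumberField.discr F) → ∃ RD : ReciprocityData F, ∀ hcpt : Literature.NumberTheory.Automorphic.isCompact_glFiniteIntegralLevel 2 F, (∀ π : Literature.NumberTheory.Automorphic.CuspidalAutomorphicRepData 2 F hcpt, π.1.IsLAlgebraic → (∃ T : Literature.NumberTheory.Automorphic.InfinityType F 2, π.1.HasInfinityType T ∧ T.IsRegular) → ∀ (ℓ : ℕ) [Fact ℓ.Prime] (ι : PadicAlgCl ℓ ≃+* ℂ), ∃ ρ : Literature.NumberTheory.GaloisRepresentations.FramedGaloisRep F (PadicAlgCl ℓ) 2, ρ.toGaloisRep.IsIrreducible ∧ IsGeometricFramed RD ρ ∧ Corresponds RD ι π.1 ρ) ∧ (∀ (ι : PadicAlgCl p ≃+* ℂ) (ρ : Literature.NumberTheory.GaloisRepresentations.FramedGaloisRep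 F (PadicAlgCl p) 2), ρ.toGaloisRep.IsIrreducible → IsGeometricFramed RD ρ → ρ.IsOdd → (∀ (v : IsDedekindDomain.HeightOneSpectrum (NumberField.RingOfIntegers F)) (hv : ((p : ℕ) : NumberField.RingOfIntegers F) ∈ v.asIdeal), letI := (RD.pst p v hv).algebra; (∃ (E : IntermediateField ℚ_[p] (PadicAlgCl p)) (_ : FiniteDimensional ℚ_[p] E) (rE : Literature.NumberTheory.GaloisRepresentations.FramedRep (Field.absoluteGaloisGroup (v.adicCompletion F)) E 2), Literature.NumberTheory.Automorphic.HasQlModel (ρ.toLocal v) E rE ∧ (Literature.NumberTheory.Automorphic.restrictScalarsQl E rE).IsDeRham (RD.pst p v hv).𝔅 ∧ ((RD.pst p v hv).𝔅.hodgeTateWeights (Literature.NumberTheory.Automorphic.restrictScalarsQl E rE)).toFinset.card = 2 * Module.finrank ℚ_[p] (v.adicCompletion F)) ∧ (∃ r, (RD.pst p v hv).IsWeilDeligneOf (ρ.toLocal v) r ∧ r.N = 0 ∧ Literature.NumberTheory.GaloisRepresentations.WeilGroup.IsUnramifiedRep r.ρ)) → (¬ ∃ χ₁ χ₂ : Field.absoluteGaloisGroup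 (CyclotomicField p F) →* (PadicAlgCl p)ˣ, IsOpen (χ₁.ker : Set (Field.absoluteGaloisGroup (CyclotomicField p F))) ∧ IsOpen (χ₂.ker : Set (Field.absoluteGaloisGroup (CyclotomicField p F))) ∧ ∀ σ, ‖((ρ.restrictField (CyclotomicField p F) σ : GL (Fin 2) (PadicAlgCl p)) : Matrix (Fin 2) (Fin 2) (PadicAlgCl p)).trace - ((χ₁ σ : PadicAlgCl p) + (χ₂ σ : PadicAlgCl p))‖ < 1) → ∃ π : Literature.NumberTheory.Automorphic.CuspidalAutomorphicRepData 2 F hcpt, π.1.IsLAlgebraic ∧ Corresponds RD ι π.1 ρ)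

-- item stmt-Langlands-2397 · crux · rank 2 · closed · moot by None · by planner — informal only, no Lean statement yet:
--   [crux] (rank 2; first open rung, cheapest kill) SEEDS OVER Q_{p^2}: for p >= 5, k >= p+2 and every
--   rhobar : G_{Q_p} -> GL_2(Fbar_p) with trivial endomorphisms, every connected component C of
--   Rozensztajn's standard subset X(k, rhobar) = {a_p : Vbar_{k,a_p}^ss = rhobar^ss} (equivalently of
--   the rigid generic fibre of Kisin's crystalline deformation ring R^psi(k, rhobar)[1/p],
--   Rozensztajn2020 Thm 1) has the property: the base changes V_{k,a_p}|_{G_{Q_{p^2}}}, a_p in C, lie on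
--   the SAME connected component of the rigid generic fibre X_{((0,k-1),(0,k-1))}(rhobar|_{G_{Q_{p^2}}})
--   as either the split cr

-- item stmt-Langlands-2413 · crux · rank 3 · closed · moot by None · by planner — informal only, no Lean statement yet:
--   [crux] (rank 3) CONJECTURE C + FINITE DETERMINATION, f <= 2: for p >= 5, K = Q_{p^f} with f <= 2,
--   every rhobar : G_K -> GL_2(Fbar_p) and every regular labelled weight lambda = (0, k_tau - 1)_tau
--   with k_tau >= 2 UNBOUNDED, every connected (= irreducible, Kisin2007: generic fibre formally smooth)
--   component of the rigid generic fibre X_lambda(rhobar) of the framed crystalline deformation ring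
--   contains a point rho such that rho|_{G_{K'}}, K' the unramified extension of degree <= 2, is
--   ordinary (G_{K'}-stable line) or a direct sum of two crystalline characters. SUB-CLAIM (to be split
--   off as a child

-- item stmt-Langlands-2406 · crux · rank 4 · closed · moot by None · by planner — informal only, no Lean statement yet:
--   [crux] (rank 4; the thesis X) PD FOR GL_2 OVER UNRAMIFIED p-ADIC FIELDS IN ALL WEIGHTS: for every p
--   >= 5 and every finite unramified K/Q_p, every crystalline rho : G_K -> GL_2(Qbar_p) with pairwise
--   distinct labelled Hodge-Tate weights is potentially diagonalisable in the sense of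
--   BarnetlambEtAl2014 §1.4; strong (census) form: rho|_{G_{K'}} for the unramified K'/K of degree <= 2
--   lies on the same irreducible component of Spec R^{cris,lambda}(rhobar|_{K'})[1/p] as an ordinary
--   representation or a direct sum of crystalline characters. Known sub-cases (become support when
--   cited): HT weights in [0,p-

/-- item stmt-Langlands-2222 · crux · rank 5 · closed · moot by None · by planner
why it might fail: A component of X_lambda(rhobar) for K = Q_{p^2}, k_tau >= p+2, may contain no potentially diagonalisable point (BLGGT 1010.2561 §1.4: 'no reason to believe'); then the slice fails for rho on it unless lifting can be done without PD.
sources: BarnetlambEtAl2014, BarnetlambGeeGeraghty2013MathAnn, BarnetlambGeeGeraghty2013MRL, Bartlett2020, GaoLiu2014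
[crux] PD-free automorphy lifting in EVERY regular weight at unramified p, census range: same as
SliceB2Unram but with the residual-automorphy hypothesis (rho trace-congruent mod m_{Zbar_p} to
rho_0 of a regular L-algebraic cuspidal pi_0) and restricted to F whose places above p all have
residue degree f_v <= 2. Equals PD2Unram(f<=2) + BLGGT Thm 4.2.1 / BLGG13 App. A (PD lifting) +
known (A)^reg_2; the glue is filed when IsPotentiallyDiagonalizable lands. WHY IT MIGHT FAIL: some
component of a crystalline deformation space of G_{Q_{p^2}} in weight k_tau >= p+2 may carry no
potentially diagonalisable point (BLGGT: 'no reason to believe' PD is universal), and even with PD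
the imported lifting needs p >= 7 and adequacy exactly as typed. Sources: BarnetlambEtAl2014 Thm
4.2.1 and §1.4; BarnetlambGeeGeraghty2013MathAnn App. A; BarnetlambGeeGeraghty2013MRL Thm 2.1.2;
Bartlett2020; GaoLiu2014. -/
@[route_item "route-Langlands-WachCensus"]
def LiftB2UnramSmallF : Prop :=
  ∀ (F : Type) [Field F] [NumberField F] [NumberField.IsTotallyReal F] (p : ℕ) [Fact p.Prime], 7 ≤ p → ¬ ((p : ℤ) ∣ NumberField.discr F) → (∀ v : IsDedekindDomain.HeightOneSpectrum (NumberField.RingOfIntegers F), ((p : ℕ) : NumberField.RingOfIntegers F) ∈ v.asIdeal → v.asIdeal.inertiaDeg ℤ ≤ 2) → ∃ RD : ReciprocityData F, ∀ hcpt : Literature.NumberTheory.Automorphic.isCompact_glFiniteIntegralLevel 2 F, (∀ π : Literature.NumberTheory.Automorphic.CuspidalAutomorphicRepData 2 F hcpt, π.1.IsLAlgebraic → (∃ T : Literature.NumberTheory.Automorphic.InfinityType F 2, π.1.HasInfinityType T ∧ T.IsRegular) → ∀ (ℓ : ℕ) [Fact ℓ.Prime] (ι : PadicAlgCl ℓ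 ≃+* ℂ), ∃ ρ : Literature.NumberTheory.GaloisRepresentations.FramedGaloisRep F (PadicAlgCl ℓ) 2, ρ.toGaloisRep.IsIrreducible ∧ IsGeometricFramed RD ρ ∧ Corresponds RD ι π.1 ρ) ∧ (∀ (ι : PadicAlgCl p ≃+* ℂ) (ρ : Literature.NumberTheory.GaloisRepresentations.FramedGaloisRep F (PadicAlgCl p) 2), ρ.toGaloisRep.IsIrreducible → IsGeometricFramed RD ρ → ρ.IsOdd → (∀ (v : IsDedekindDomain.HeightOneSpectrum (NumberField.RingOfIntegers F)) (hv : ((p : ℕ) : NumberField.RingOfIntegers F) ∈ v.asIdeal), letI := (RD.pst p v hv).algebra; (∃ (E : IntermediateField ℚ_[p] (PadicAlgCl p)) (_ : FiniteDimensional ℚ_[p] E) (rE : Literature.NumberTheory.GaloisRepresentations.FramedRep (Field.absoluteGaloisGroup (v.adicCompletion F)) E 2), Literature.NumberTheory.Automorphic.HasQlModel (ρ.toLocal v) E rE ∧ (Literature.NumberTheory.Automorphic.restrictScalarsQl E rE).IsDeRham (RD.pst p v hv).𝔅 ∧ ((RD.pst p v hv).𝔅.hodgeTateWeights (Literature.NumberTheory.Automorphic.restrictScalarsQl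 E rE)).toFinset.card = 2 * Module.finrank ℚ_[p] (v.adicCompletion F)) ∧ (∃ r, (RD.pst p v hv).IsWeilDeligneOf (ρ.toLocal v) r ∧ r.N = 0 ∧ Literature.NumberTheory.GaloisRepresentations.WeilGroup.IsUnramifiedRep r.ρ)) → (¬ ∃ χ₁ χ₂ : Field.absoluteGaloisGroup (CyclotomicField p F) →* (PadicAlgCl p)ˣ, IsOpen (χ₁.ker : Set (Field.absoluteGaloisGroup (CyclotomicField p F))) ∧ IsOpen (χ₂.ker : Set (Field.absoluteGaloisGroup (CyclotomicField p F))) ∧ ∀ σ, ‖((ρ.restrictField (CyclotomicField p F) σ : GL (Fin 2) (PadicAlgCl p)) : Matrix (Fin 2) (Fin 2) (PadicAlgCl p)).trace - ((χ₁ σ : PadicAlgCl p) + (χ₂ σ : PadicAlgCl p))‖ < 1) → (∃ (π₀ : Literature.NumberTheory.Automorphic.CuspidalAutomorphicRepData 2 F hcpt) (ρ₀ : Literature.NumberTheory.GaloisRepresentations.FramedGaloisRep F (PadicAlgCl p) 2), π₀.1.IsLAlgebraic ∧ (∃ T : Literature.NumberTheory.Automorphic.InfinityType F 2, π₀.1.HasInfinityType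 T ∧ T.IsRegular) ∧ Corresponds RD ι π₀.1 ρ₀ ∧ ∀ σ, ‖((ρ σ : GL (Fin 2) (PadicAlgCl p)) : Matrix (Fin 2) (Fin 2) (PadicAlgCl p)).trace - ((ρ₀ σ : GL (Fin 2) (PadicAlgCl p)) : Matrix (Fin 2) (Fin 2) (PadicAlgCl p)).trace‖ < 1) → ∃ π : Literature.NumberTheory.Automorphic.CuspidalAutomorphicRepData 2 F hcpt, π.1.IsLAlgebraic ∧ Corresponds RD ι π.1 ρ)

/-- item stmt-Langlands-2223 · crux · rank 6 · closed · moot by None · by planner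
why it might fail: For f >= 3 the crystalline generic fibres are f-dimensional; components not crossed by any explicit (Dousmanis/Guzman, large-valuation) family may exist, so the f <= 2 census pattern may not extrapolate and PD may fail first at f = 3.
sources: Dousmanis2010, Guzman2024, BarnetlambEtAl2014
[crux] the same PD-free lifting slice when SOME place above p has residue degree f_v >= 3 — beyond
the certified-census range; rests on PD2Unram for all unramified f, to be reached from the pattern
(component types = ordinary / split-after-unramified-quadratic-base-change) found for f <= 2 and
proved by Dousmanis/Guzman-type families, which exist for every f. WHY IT MIGHT FAIL: for f >= 3 the
generic fibres have dimension f and components invisible to every explicit bounded-valuation family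
may appear; the f <= 2 pattern need not persist. Sources: Dousmanis2010; Guzman2024;
BarnetlambEtAl2014 §1.4. -/
@[route_item "route-Langlands-WachCensus"]
def LiftB2UnramLargeF : Prop :=
  ∀ (F : Type) [Field F] [NumberField F] [NumberField.IsTotallyReal F] (p : ℕ) [Fact p.Prime], 7 ≤ p → ¬ ((p : ℤ) ∣ NumberField.discr F) → (∃ v : IsDedekindDomain.HeightOneSpectrum (NumberField.RingOfIntegers F), ((p : ℕ) : NumberField.RingOfIntegers F) ∈ v.asIdeal ∧ 3 ≤ v.asIdeal.inertiaDeg ℤ) → ∃ RD : ReciprocityData F, ∀ hcpt : Literature.NumberTheory.Automorphic.isCompact_glFiniteIntegralLevel 2 F, (∀ π : Literature.NumberTheory.Automorphic.CuspidalAutomorphicRepData 2 F hcpt, π.1.IsLAlgebraic → (∃ T : Literature.NumberTheory.Automorphic.InfinityType F 2, π.1.HasInfinityType T ∧ T.IsRegular) → ∀ (ℓ : ℕ) [Fact ℓ.Prime] (ι : PadicAlgCl ℓ ≃+* ℂ), ∃ ρ : Literature.NumberTheory.GaloisRepresentations.FramedGaloisRep F (PadicAlgCl ℓ) 2, ρ.toGaloisRep.IsIrreducible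 ∧ IsGeometricFramed RD ρ ∧ Corresponds RD ι π.1 ρ) ∧ (∀ (ι : PadicAlgCl p ≃+* ℂ) (ρ : Literature.NumberTheory.GaloisRepresentations.FramedGaloisRep F (PadicAlgCl p) 2), ρ.toGaloisRep.IsIrreducible → IsGeometricFramed RD ρ → ρ.IsOdd → (∀ (v : IsDedekindDomain.HeightOneSpectrum (NumberField.RingOfIntegers F)) (hv : ((p : ℕ) : NumberField.RingOfIntegers F) ∈ v.asIdeal), letI := (RD.pst p v hv).algebra; (∃ (E : IntermediateField ℚ_[p] (PadicAlgCl p)) (_ : FiniteDimensional ℚ_[p] E) (rE : Literature.NumberTheory.GaloisRepresentations.FramedRep (Field.absoluteGaloisGroup (v.adicCompletion F)) E 2), Literature.NumberTheory.Automorphic.HasQlModel (ρ.toLocal v) E rE ∧ (Literature.NumberTheory.Automorphic.restrictScalarsQl E rE).IsDeRham (RD.pst p v hv).𝔅 ∧ ((RD.pst p v hv).𝔅.hodgeTateWeights (Literature.NumberTheory.Automorphic.restrictScalarsQl E rE)).toFinset.card = 2 * Module.finrank ℚ_[p] (v.adicCompletion F)) ∧ (∃ r, (RD.pst p v hv).IsWeilDeligneOf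 (ρ.toLocal v) r ∧ r.N = 0 ∧ Literature.NumberTheory.GaloisRepresentations.WeilGroup.IsUnramifiedRep r.ρ)) → (¬ ∃ χ₁ χ₂ : Field.absoluteGaloisGroup (CyclotomicField p F) →* (PadicAlgCl p)ˣ, IsOpen (χ₁.ker : Set (Field.absoluteGaloisGroup (CyclotomicField p F))) ∧ IsOpen (χ₂.ker : Set (Field.absoluteGaloisGroup (CyclotomicField p F))) ∧ ∀ σ, ‖((ρ.restrictField (CyclotomicField p F) σ : GL (Fin 2) (PadicAlgCl p)) : Matrix (Fin 2) (Fin 2) (PadicAlgCl p)).trace - ((χ₁ σ : PadicAlgCl p) + (χ₂ σ : PadicAlgCl p))‖ < 1) → (∃ (π₀ : Literature.NumberTheory.Automorphic.CuspidalAutomorphicRepData 2 F hcpt) (ρ₀ : Literature.NumberTheory.GaloisRepresentations.FramedGaloisRep F (PadicAlgCl p) 2), π₀.1.IsLAlgebraic ∧ (∃ T : Literature.NumberTheory.Automorphic.InfinityType F 2, π₀.1.HasInfinityType T ∧ T.IsRegular) ∧ Corresponds RD ι π₀.1 ρ₀ ∧ ∀ σ, ‖((ρ σ : GL (Fin 2)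 (PadicAlgCl p)) : Matrix (Fin 2) (Fin 2) (PadicAlgCl p)).trace - ((ρ₀ σ : GL (Fin 2) (PadicAlgCl p)) : Matrix (Fin 2) (Fin 2) (PadicAlgCl p)).trace‖ < 1) → ∃ π : Literature.NumberTheory.Automorphic.CuspidalAutomorphicRepData 2 F hcpt, π.1.IsLAlgebraic ∧ Corresponds RD ι π.1 ρ)

/-- item stmt-Langlands-2224 · support · rank 9 · closed · moot by None · by planner
sources: BuzzardDiamondJarvis2010, KhareWintenberger2009
[support] CARRIED HYPOTHESIS (the route is a conditional bridge on it; NOT attacked here):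
Buzzard-Diamond-Jarvis residual modularity over totally real F (BuzzardDiamondJarvis2010 Conj. 1.1,
modularity part): for p >= 3 and ANY reciprocity data RD satisfying the (A)-direction for regular
L-algebraic cuspidal pi of GL_2/F, every continuous totally odd rho : G_F -> GL_2(Qbar_p) whose
reduction is absolutely irreducible on G_{F(zeta_p)} is trace-congruent mod m_{Zbar_p} to the rho_0
of some regular L-algebraic cuspidal pi_0 (forall-RD form is safe here: RD enters only through
Corresponds on automorphic pairs, which (A) supplies). Known for F = Q (KhareWintenberger2009).
Shared decl: other (B)-routes for GL_2 over totally real fields may attach. -/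
@[route_item "route-Langlands-WachCensus"]
def SerreModularityTR : Prop :=
  ∀ (F : Type) [Field F] [NumberField F] [NumberField.IsTotallyReal F] (p : ℕ) [Fact p.Prime], 3 ≤ p → ∀ (RD : ReciprocityData F) (hcpt : Literature.NumberTheory.Automorphic.isCompact_glFiniteIntegralLevel 2 F), (∀ π : Literature.NumberTheory.Automorphic.CuspidalAutomorphicRepData 2 F hcpt, π.1.IsLAlgebraic → (∃ T : Literature.NumberTheory.Automorphic.InfinityType F 2, π.1.HasInfinityType T ∧ T.IsRegular) → ∀ (ℓ : ℕ) [Fact ℓ.Prime] (ι : PadicAlgCl ℓ ≃+* ℂ), ∃ ρ : Literature.NumberTheory.GaloisRepresentations.FramedGaloisRep F (PadicAlgCl ℓ) 2, ρ.toGaloisRep.IsIrreducible ∧ IsGeometricFramed RD ρ ∧ Corresponds RD ι π.1 ρ) → (∀ (ι : PadicAlgCl p ≃+* ℂ) (ρ : Literature.NumberTheory.GaloisRepresentations.FramedGaloisRep F (PadicAlgCl p) 2), ρ.IsOdd → (¬ ∃ χ₁ χ₂ : Field.absoluteGaloisGroup (CyclotomicField p F) →* (PadicAlgCl p)ˣ,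 IsOpen (χ₁.ker : Set (Field.absoluteGaloisGroup (CyclotomicField p F))) ∧ IsOpen (χ₂.ker : Set (Field.absoluteGaloisGroup (CyclotomicField p F))) ∧ ∀ σ, ‖((ρ.restrictField (CyclotomicField p F) σ : GL (Fin 2) (PadicAlgCl p)) : Matrix (Fin 2) (Fin 2) (PadicAlgCl p)).trace - ((χ₁ σ : PadicAlgCl p) + (χ₂ σ : PadicAlgCl p))‖ < 1) → (∃ (π₀ : Literature.NumberTheory.Automorphic.CuspidalAutomorphicRepData 2 F hcpt) (ρ₀ : Literature.NumberTheory.GaloisRepresentations.FramedGaloisRep F (PadicAlgCl p) 2), π₀.1.IsLAlgebraic ∧ (∃ T : Literature.NumberTheory.Automorphic.InfinityType F 2, π₀.1.HasInfinityType T ∧ T.IsRegular) ∧ Corresponds RD ι π₀.1 ρ₀ ∧ ∀ σ, ‖((ρ σ : GL (Fin 2) (PadicAlgCl p)) : Matrix (Fin 2) (Fin 2) (PadicAlgCl p)).trace - ((ρ₀ σ : GL (Fin 2) (PadicAlgCl p)) : Matrix (Fin 2) (Fin 2) (PadicAlgCl p)).trace‖ < 1))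

-- item stmt-Langlands-2454 · support · rank 9 · closed · moot by None · by planner — informal only, no Lean statement yet:
--   [support] NAMED FACTS (cite items filed) — the glue ComponentCensusUnram -> PD2Unram: (i) Kisin2007
--   (Thm 3.3.8 / Cor.): the generic fibre Spec R^{square,cris,lambda}(rhobar)[1/p] is formally smooth
--   over Q_p and equidimensional, hence regular, so its irreducible components are its connected
--   components and 'connects' is an equivalence relation; (ii) BarnetlambEtAl2014 §1.4 (pp. 14-15 of
--   arXiv:1010.2561, read): if rho_1 ~ rho_2 then rho_1|_{G_{K'}} ~ rho_2|_{G_{K'}} for finite K'/K;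
--   sums and tensor products respect ~; rho ~ rho (x) mu for unramified mu with trivial reduction; an
--   invariant filtrat

-- item stmt-Langlands-2455 · support · rank 9 · closed · moot by None · by planner — informal only, no Lean statement yet:
--   [support] NAMED FACT (cite item filed) — the glue PD2Unram -> LiftB2UnramSmallF / LiftB2UnramLargeF:
--   potentially-diagonalisable automorphy lifting for GL_2 over totally real fields. For F totally real,
--   p >= 7, rho : G_F -> GL_2(Qbar_p) continuous irreducible, unramified almost everywhere, totally odd,
--   with rhobar|_{G_{F(zeta_p)}} irreducible (adequate) and rhobar = rbar_{p,iota}(pi_0) for a regular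
--   algebraic cuspidal pi_0, and with rho|_{G_{F_v}} potentially diagonalisable with distinct labelled
--   Hodge-Tate weights for every v | p: rho is automorphic (rho = r_{p,iota}(pi) for a regular L-algebr

/-- item stmt-Langlands-3347 · support · rank 9 · closed · moot by None · by planner
sources: HarrisTaylorAMS2001, HenniartInventiones2000, FontaineAsterisque223III, HarrisLanTaylorThorneRMS2016
[support] (route-repair rrepair-Langlands-WachCensus-096167f2) NEEDS-FACT CARRIER for the ∃-RD items
of this route. needs-fact: Literature.NumberTheory.Automorphic.LocalLanglandsDatum.nonempty ;
needs-fact: Literature.NumberTheory.GaloisRepresentations.PstWeilDeligneData.nonempty ; needs-fact: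
Literature.NumberTheory.Automorphic.exists_galoisRep_of_regularAlgebraic . The first two are the
named Literature facts (local Langlands for GL_n of every completion K_v: Harris–Taylor 2001 Thm A,
Henniart 2000 Thm 1.2; Fontaine's B_dR / WD∘D_pst data at v | l: Astérisque 223 Exp. III, VIII)
without which no `ReciprocityData F` exists (planner Sketch.lean
`nonempty_reciprocityData_of_inputs`, lean check rc 0: these two + a Q_l-algebra structure on K_v
for v | l — absent from Mathlib, no Literature construction — build it; nothing in the library has
ever built one), hence without which SliceB2Unram / LiftB2UnramSmallF / LiftB2UnramLargeF (shape `∃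
RD, (A)^reg_2 ∧ slice`) are unprovable whatever the census shows. Both are UNPROVED (no qualified
`_holds`) although the debt census counts them proved (it keys `proved` on the short name and
unrelated `nonempty_holds` theorems exist in FluidPDE) — t -/
@[route_item "route-Langlands-WachCensus"]
def ReciprocityDataInputs : Prop :=
  Literature.NumberTheory.Automorphic.LocalLanglandsDatum.nonempty ∧ Literature.NumberTheory.GaloisRepresentations.PstWeilDeligneData.nonempty

/-- item stmt-Langlands-2225 · assembly · rank 1 · closed · moot by None · by planner
sources: BarnetlambEtAl2014
[assembly] LiftB2UnramSmallF -> LiftB2UnramLargeF -> SerreModularityTR -> SliceB2Unram: case split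
on the residue degrees of the places above p, then feed the residual modularity (instantiated at the
SAME datum RD via its (A)-conjunct) into the lifting slice. Elementary; a proof (`assembly_holds`,
by_cases + omega) is attached as evidence from the planner's Sketch2.lean. The informal cruxes
SeedsOverQp2 (r2), ComponentCensusUnram (r3), PD2Unram (r4) feed LiftB2Unram* through the cite facts
PDCalculusFacts and PDLiftingGL2 once IsPotentiallyDiagonalizable / CrystallineDeformationSpace are
defined (definition items filed). -/
@[route_item "route-Langlands-WachCensus"]
def Assembly : Prop :=
  LiftB2UnramSmallF → LiftB2UnramLargeF → SerreModularityTR → SliceB2Unram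

end Summit.Langlands.Langlands.Theses.WachCensus
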